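import Mathlib
import Summits.ValiantsHypothesis.ValiantsHypothesis.Theorems.ValuativeGCTValuativeFlipPencilBorderTools

/-!
# The bordering transfer `n + 1 → n + 2` for four-variable permanental pencil ranks
# (crux `ValuativeGCT.ValuativeFlip`, stmt-ValiantsHypothesis-12624; wall-breaker axis k8 gen 1)

Helper file (`--supports stmt-ValiantsHypothesis-12624`), line `four-row-count`, stub
`stub_fourRowPencilRank` in its `m`-free form `H` (`fourRowPencilRank_of_pencilCertificate`, p112144):
`H : ∃ n₀, ∀ n ≥ n₀, ∃ M c, IsUnit (4 cells) ∧ 2⌊6n/5⌋² + ⌊6n/5⌋ + 2 ≤ s(M)`, where for a four-variable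
pencil `M : Fin n × Fin n → Fin 4 → ℂ` (entry `(i,j)` is the linear form `Σ_t M (i,j) t · y_t`)
`s(M) := finrank span{y_t · Per_{kl}(M(y)) : t, k, l}` (`Per_{kl}` = permanental minor = `∂_{kl} per`).

THE TRANSFER (`pencilRank_border_transfer`).  Border `M` by a column of forms `u`, a row of forms `v`
and a corner `c · w`:  `M' = [[M, u], [vᵀ, c·w]]`.  For all but finitely many corner scales `c` (we
state: for some `c ≠ 0`)
  `s(M') ≥ dim ( w·V(M) + ⟨y_t · per M⟩_t + ⟨y_t · Σ_l v_l Per_{kl}(M)⟩_{t,k} + ⟨y_t · Σ_k u_k Per_{kl}(M)⟩_{t,l} )`,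
because after multiplying the old-block minors of `M'` by `μ = 1/c` the whole family of products of
`M'` is AFFINE in `μ` (`Per'_{kl} = c·w·Per_{kl} + Q_{kl}`, `Per'_{k,last} = Σ_l v_l Per_{kl}`,
`Per'_{last,l} = Σ_k u_k Per_{kl}`, `Per'_{last,last} = per M`; `…PencilBorderTools`), its value at
`μ = 0` spans exactly the displayed space, and an affine family attains at least its `μ = 0` rank at all
but finitely many `μ` (`pb_finite_setOf_finrank_lt`).  The new pencil EXTENDS `M` (top-left block), so
independent coordinate cells of `M` stay independent cells of `M'`.

Numerically (exact ranks modulo `2⁶¹ - 1`, seat folder `compute/border.c`, dense generic data,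
`n = 7 … 22`) the right-hand side exceeds `s(M)` by exactly `6n + 2` at inner size `n` (the true
increment of the generic value `4n² - 2n + 2` is `8n + 2`; the missing `2n` are second-order terms),
so iterating the transfer gives `s ≥ 3n² - O(n)`, above the line's threshold `2(6n/5)² + 6n/5 + 2`
for all large `n` — see `…PencilBorderChain` for the graded iteration that makes the increment a
statement about ONE explicit three-variable pencil pattern.  [this crux, line four-row-count; folklore
(semicontinuity of rank, Laplace expansion)]
-/

set_option linter.dupNamespace false

namespace Summit.ValiantsHypothesis.ValiantsHypothesis.Theorems.ValuativeFlip

open scoped BigOperators Matrix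
open MvPolynomial Literature.Computability.AlgebraicComplexity

/-- **Bordering transfer for four-variable permanental pencil ranks** (inner size `n+1 → n+2`).
For a pencil `M` of size `n + 1`, border forms `u, v : Fin (n+1) → (Fin 4 → ℂ)` and a corner form
`w`, there are a scale `c ≠ 0` and a pencil `M'` of size `n + 2` with `M'|_{old × old} = M`,
`M'(i, last) = u i`, `M'(last, j) = v j`, `M'(last, last) = c • w`, whose product span
`span{y_t · (∂_{KL} per_{n+2})(M')}` has dimension at least that of
`w · span{y_t · (∂_{kl} per_{n+1})(M)} ⊔ span{y_t · per_{n+1}(M)} ⊔ span{y_t · Σ_l v_l (∂_{kl} per)(M)}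
 ⊔ span{y_t · Σ_k u_k (∂_{kl} per)(M)}`.  [this crux, line four-row-count; folklore] -/
theorem pencilRank_border_transfer (n : ℕ) (M : Fin (n + 1) × Fin (n + 1) → Fin 4 → ℂ)
    (u v : Fin (n + 1) → Fin 4 → ℂ) (w : Fin 4 → ℂ) :
    ∃ (c : ℂ) (M' : Fin (n + 2) × Fin (n + 2) → Fin 4 → ℂ), c ≠ 0 ∧
      (∀ i j, M' (Fin.castSucc i, Fin.castSucc j) = M (i, j)) ∧
      (∀ i, M' (Fin.castSucc i, Fin.last (n + 1)) = u i) ∧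
      (∀ j, M' (Fin.last (n + 1), Fin.castSucc j) = v j) ∧
      M' (Fin.last (n + 1), Fin.last (n + 1)) = c • w ∧
      Module.finrank ℂ ↥(
        (Submodule.span ℂ (Set.range fun tc : Fin 4 × (Fin (n + 1) × Fin (n + 1)) =>
          (X tc.1 : MvPolynomial (Fin 4) ℂ) *
            aeval (fun ij : Fin (n + 1) × Fin (n + 1) => ∑ t : Fin 4, M ij t • (X t : MvPolynomial (Fin 4) ℂ))
              (pderiv tc.2 (perPoly (Fin (n + 1)) ℂ)))).map
          (LinearMap.mulLeft ℂ (∑ t : Fin 4, w t • (X t : MvPolynomial (Fin 4) ℂ)))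
        ⊔ Submodule.span ℂ (Set.range fun t : Fin 4 =>
          (X t : MvPolynomial (Fin 4) ℂ) *
            aeval (fun ij : Fin (n + 1) × Fin (n + 1) => ∑ t : Fin 4, M ij t • (X t : MvPolynomial (Fin 4) ℂ))
              (perPoly (Fin (n + 1)) ℂ))
        ⊔ Submodule.span ℂ (Set.range fun tk : Fin 4 × Fin (n + 1) =>
          (X tk.1 : MvPolynomial (Fin 4) ℂ) *
            ∑ l : Fin (n + 1), (∑ t : Fin 4, v l t • (X t : MvPolynomial (Fin 4) ℂ)) *
              aeval (fun ij : Fin (n + 1) × Fin (n + 1) => ∑ t : Fin 4, M ij t • (X t : MvPolynomial (Fin 4) ℂ))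
                (pderiv (tk.2, l) (perPoly (Fin (n + 1)) ℂ)))
        ⊔ Submodule.span ℂ (Set.range fun tl : Fin 4 × Fin (n + 1) =>
          (X tl.1 : MvPolynomial (Fin 4) ℂ) *
            ∑ k : Fin (n + 1), (∑ t : Fin 4, u k t • (X t : MvPolynomial (Fin 4) ℂ)) *
              aeval (fun ij : Fin (n + 1) × Fin (n + 1) => ∑ t : Fin 4, M ij t • (X t : MvPolynomial (Fin 4) ℂ))
                (pderiv (k, tl.2) (perPoly (Fin (n + 1)) ℂ)))) ≤
      Module.finrank ℂ ↥(Submodule.span ℂ (Set.range fun tc : Fin 4 × (Fin (n + 2) × Fin (n + 2)) =>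
          (X tc.1 : MvPolynomial (Fin 4) ℂ) *
            aeval (fun ij : Fin (n + 2) × Fin (n + 2) => ∑ t : Fin 4, M' ij t • (X t : MvPolynomial (Fin 4) ℂ))
              (pderiv tc.2 (perPoly (Fin (n + 2)) ℂ)))) := by
  classical
  -- linear forms and the pencil matrix of `M`
  set lin : (Fin 4 → ℂ) → MvPolynomial (Fin 4) ℂ := fun a => ∑ t : Fin 4, a t • (X t : MvPolynomial (Fin 4) ℂ)
    with hlin
  have hlin_smul : ∀ (c : ℂ) (a : Fin 4 → ℂ), lin (c • a) = c • lin a := by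
    intro c a
    simp only [hlin, Pi.smul_apply, smul_eq_mul, Finset.smul_sum, smul_smul]
  have hlin_zero : lin 0 = 0 := by simp [hlin]
  set A : Matrix (Fin (n + 1)) (Fin (n + 1)) (MvPolynomial (Fin 4) ℂ) :=
    Matrix.of fun i j => lin (M (i, j)) with hA
  -- the bordered pencils, one for each corner scale
  let bord : ℂ → (Fin (n + 2) × Fin (n + 2) → Fin 4 → ℂ) := fun c p =>
    Fin.snoc (α := fun _ => Fin 4 → ℂ)
      (fun i : Fin (n + 1) => (Fin.snoc (α := fun _ => Fin 4 → ℂ) (fun j : Fin (n + 1) => M (i, j)) (u i)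
        : Fin (n + 2) → Fin 4 → ℂ) p.2)
      ((Fin.snoc (α := fun _ => Fin 4 → ℂ) v (c • w) : Fin (n + 2) → Fin 4 → ℂ) p.2) p.1
  have hb11 : ∀ c i j, bord c (Fin.castSucc i, Fin.castSucc j) = M (i, j) := by
    intro c i j; simp [bord]
  have hb12 : ∀ c i, bord c (Fin.castSucc i, Fin.last (n + 1)) = u i := by
    intro c i; simp [bord]
  have hb21 : ∀ c j, bord c (Fin.last (n + 1), Fin.castSucc j) = v j := by
    intro c j; simp [bord]
  have hb22 : ∀ c, bord c (Fin.last (n + 1), Fin.last (n + 1)) = c • w := by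
    intro c; simp [bord]
  -- their pencil matrices
  let B : ℂ → Matrix (Fin (n + 2)) (Fin (n + 2)) (MvPolynomial (Fin 4) ℂ) := fun c =>
    Matrix.of fun I J => lin (bord c (I, J))
  have hBA : ∀ c i j, B c (Fin.castSucc i) (Fin.castSucc j) = A i j := by
    intro c i j; simp only [B, Matrix.of_apply, hb11, hA]
  have hBu : ∀ c i, B c (Fin.castSucc i) (Fin.last (n + 1)) = lin (u i) := by
    intro c i; simp only [B, Matrix.of_apply, hb12]
  have hBv : ∀ c j, B c (Fin.last (n + 1)) (Fin.castSucc j) = lin (v j) := by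
    intro c j; simp only [B, Matrix.of_apply, hb21]
  have hBw : ∀ c, B c (Fin.last (n + 1)) (Fin.last (n + 1)) = c • lin w := by
    intro c; simp only [B, Matrix.of_apply, hb22, hlin_smul]
  have hrows : ∀ c i j, B 0 (Fin.castSucc i) j = B c (Fin.castSucc i) j := by
    intro c i j
    refine Fin.lastCases ?_ (fun j' => ?_) j
    · rw [hBu, hBu]
    · rw [hBA, hBA]
  have hlastrow : ∀ c j, B 0 (Fin.last (n + 1)) (Fin.castSucc j) = B c (Fin.last (n + 1)) (Fin.castSucc j) := by
    intro c j; rw [hBv, hBv]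
  have hcorner0 : B 0 (Fin.last (n + 1)) (Fin.last (n + 1)) = 0 := by
    rw [hBw, zero_smul]
  -- minors of the pencils as values of `∂ per`
  have hminor : ∀ k l : Fin (n + 1),
      aeval (fun ij : Fin (n + 1) × Fin (n + 1) => ∑ t : Fin 4, M ij t • (X t : MvPolynomial (Fin 4) ℂ))
        (pderiv (k, l) (perPoly (Fin (n + 1)) ℂ)) = (A.submatrix k.succAbove l.succAbove).permanent := by
    intro k l
    rw [pb_aeval_pderiv_perPoly]
  have hper : aeval (fun ij : Fin (n + 1) × Fin (n + 1) => ∑ t : Fin 4, M ij t • (X t : MvPolynomial (Fin 4) ℂ))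
      (perPoly (Fin (n + 1)) ℂ) = A.permanent := by
    rw [pb_aeval_perPoly]
  have hminor' : ∀ c (K L : Fin (n + 2)),
      aeval (fun ij : Fin (n + 2) × Fin (n + 2) => ∑ t : Fin 4, bord c ij t • (X t : MvPolynomial (Fin 4) ℂ))
        (pderiv (K, L) (perPoly (Fin (n + 2)) ℂ)) = ((B c).submatrix K.succAbove L.succAbove).permanent := by
    intro c K L
    rw [pb_aeval_pderiv_perPoly]
  -- finite-dimensionality of the target span
  haveI hfinV : ∀ c, Module.Finite ℂ ↥(Submodule.span ℂ (Set.range fun tc : Fin 4 × (Fin (n + 2) × Fin (n + 2)) =>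
      (X tc.1 : MvPolynomial (Fin 4) ℂ) *
        aeval (fun ij : Fin (n + 2) × Fin (n + 2) => ∑ t : Fin 4, bord c ij t • (X t : MvPolynomial (Fin 4) ℂ))
          (pderiv tc.2 (perPoly (Fin (n + 2)) ℂ)))) := fun c =>
    Module.Finite.span_of_finite ℂ (Set.finite_range _)
  -- generators of the target span
  have hgen : ∀ c (t : Fin 4) (K L : Fin (n + 2)),
      (X t : MvPolynomial (Fin 4) ℂ) * ((B c).submatrix K.succAbove L.succAbove).permanent ∈
        Submodule.span ℂ (Set.range fun tc : Fin 4 × (Fin (n + 2) × Fin (n + 2)) =>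
          (X tc.1 : MvPolynomial (Fin 4) ℂ) *
            aeval (fun ij : Fin (n + 2) × Fin (n + 2) => ∑ t : Fin 4, bord c ij t • (X t : MvPolynomial (Fin 4) ℂ))
              (pderiv tc.2 (perPoly (Fin (n + 2)) ℂ))) := by
    intro c t K L
    rw [← hminor' c K L]
    exact Submodule.subset_span ⟨(t, (K, L)), rfl⟩
  -- the affine family: value at `μ = 0` spans the displayed space, value at `μ` lies in the target
  let F₁ : Fin 4 × (Fin (n + 1) × Fin (n + 1)) → MvPolynomial (Fin 4) ℂ := fun tc =>
    lin w * ((X tc.1 : MvPolynomial (Fin 4) ℂ) *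
      aeval (fun ij : Fin (n + 1) × Fin (n + 1) => ∑ t : Fin 4, M ij t • (X t : MvPolynomial (Fin 4) ℂ))
        (pderiv tc.2 (perPoly (Fin (n + 1)) ℂ)))
  let F₂ : Fin 4 → MvPolynomial (Fin 4) ℂ := fun t =>
    (X t : MvPolynomial (Fin 4) ℂ) *
      aeval (fun ij : Fin (n + 1) × Fin (n + 1) => ∑ t : Fin 4, M ij t • (X t : MvPolynomial (Fin 4) ℂ))
        (perPoly (Fin (n + 1)) ℂ)
  let F₃ : Fin 4 × Fin (n + 1) → MvPolynomial (Fin 4) ℂ := fun tk =>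
    (X tk.1 : MvPolynomial (Fin 4) ℂ) *
      ∑ l : Fin (n + 1), (∑ t : Fin 4, v l t • (X t : MvPolynomial (Fin 4) ℂ)) *
        aeval (fun ij : Fin (n + 1) × Fin (n + 1) => ∑ t : Fin 4, M ij t • (X t : MvPolynomial (Fin 4) ℂ))
          (pderiv (tk.2, l) (perPoly (Fin (n + 1)) ℂ))
  let F₄ : Fin 4 × Fin (n + 1) → MvPolynomial (Fin 4) ℂ := fun tl =>
    (X tl.1 : MvPolynomial (Fin 4) ℂ) *
      ∑ k : Fin (n + 1), (∑ t : Fin 4, u k t • (X t : MvPolynomial (Fin 4) ℂ)) *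
        aeval (fun ij : Fin (n + 1) × Fin (n + 1) => ∑ t : Fin 4, M ij t • (X t : MvPolynomial (Fin 4) ℂ))
          (pderiv (k, tl.2) (perPoly (Fin (n + 1)) ℂ))
  let G₀ : (Fin 4 × (Fin (n + 1) × Fin (n + 1))) ⊕ (Fin 4 ⊕ ((Fin 4 × Fin (n + 1)) ⊕ (Fin 4 × Fin (n + 1)))) →
      MvPolynomial (Fin 4) ℂ := Sum.elim F₁ (Sum.elim F₂ (Sum.elim F₃ F₄))
  let Q₁ : Fin 4 × (Fin (n + 1) × Fin (n + 1)) → MvPolynomial (Fin 4) ℂ := fun tc =>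
    (X tc.1 : MvPolynomial (Fin 4) ℂ) *
      ((B 0).submatrix (Fin.castSucc tc.2.1).succAbove (Fin.castSucc tc.2.2).succAbove).permanent
  let G₁ : (Fin 4 × (Fin (n + 1) × Fin (n + 1))) ⊕ (Fin 4 ⊕ ((Fin 4 × Fin (n + 1)) ⊕ (Fin 4 × Fin (n + 1)))) →
      MvPolynomial (Fin 4) ℂ := Sum.elim Q₁ 0
  obtain ⟨μ, hμ0, hμ⟩ := pb_exists_ne_zero_finrank_le (K := ℂ) G₀ G₁
  refine ⟨μ⁻¹, bord μ⁻¹, inv_ne_zero hμ0, hb11 _, hb12 _, hb21 _, hb22 _, ?_⟩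
  -- (1) the displayed space is contained in `span (range G₀)`
  haveI : Module.Finite ℂ ↥(Submodule.span ℂ (Set.range G₀)) :=
    Module.Finite.span_of_finite ℂ (Set.finite_range _)
  have hG₀ : ∀ i, G₀ i ∈ Submodule.span ℂ (Set.range G₀) := fun i => Submodule.subset_span ⟨i, rfl⟩
  have hN : (Submodule.span ℂ (Set.range fun tc : Fin 4 × (Fin (n + 1) × Fin (n + 1)) =>
          (X tc.1 : MvPolynomial (Fin 4) ℂ) *
            aeval (fun ij : Fin (n + 1) × Fin (n + 1) => ∑ t : Fin 4, M ij t • (X t : MvPolynomial (Fin 4) ℂ))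
              (pderiv tc.2 (perPoly (Fin (n + 1)) ℂ)))).map
          (LinearMap.mulLeft ℂ (∑ t : Fin 4, w t • (X t : MvPolynomial (Fin 4) ℂ)))
        ⊔ Submodule.span ℂ (Set.range fun t : Fin 4 =>
          (X t : MvPolynomial (Fin 4) ℂ) *
            aeval (fun ij : Fin (n + 1) × Fin (n + 1) => ∑ t : Fin 4, M ij t • (X t : MvPolynomial (Fin 4) ℂ))
              (perPoly (Fin (n + 1)) ℂ))
        ⊔ Submodule.span ℂ (Set.range fun tk : Fin 4 × Fin (n + 1) =>
          (X tk.1 : MvPolynomial (Fin 4) ℂ) *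
            ∑ l : Fin (n + 1), (∑ t : Fin 4, v l t • (X t : MvPolynomial (Fin 4) ℂ)) *
              aeval (fun ij : Fin (n + 1) × Fin (n + 1) => ∑ t : Fin 4, M ij t • (X t : MvPolynomial (Fin 4) ℂ))
                (pderiv (tk.2, l) (perPoly (Fin (n + 1)) ℂ)))
        ⊔ Submodule.span ℂ (Set.range fun tl : Fin 4 × Fin (n + 1) =>
          (X tl.1 : MvPolynomial (Fin 4) ℂ) *
            ∑ k : Fin (n + 1), (∑ t : Fin 4, u k t • (X t : MvPolynomial (Fin 4) ℂ)) *
              aeval (fun ij : Fin (n + 1) × Fin (n + 1) => ∑ t : Fin 4, M ij t • (X t : MvPolynomial (Fin 4) ℂ))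
                (pderiv (k, tl.2) (perPoly (Fin (n + 1)) ℂ))) ≤
      Submodule.span ℂ (Set.range G₀) := by
    refine sup_le (sup_le (sup_le ?_ ?_) ?_) ?_
    · rw [Submodule.map_le_iff_le_comap, Submodule.span_le]
      rintro _ ⟨tc, rfl⟩
      exact hG₀ (Sum.inl tc)
    · rw [Submodule.span_le]
      rintro _ ⟨t, rfl⟩
      exact hG₀ (Sum.inr (Sum.inl t))
    · rw [Submodule.span_le]
      rintro _ ⟨tk, rfl⟩
      exact hG₀ (Sum.inr (Sum.inr (Sum.inl tk)))
    · rw [Submodule.span_le]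
      rintro _ ⟨tl, rfl⟩
      exact hG₀ (Sum.inr (Sum.inr (Sum.inr tl)))
  -- (2) the value at `μ` lies in the product span of the bordered pencil with corner scale `μ⁻¹`
  have hGμ : Submodule.span ℂ (Set.range fun i => G₀ i + μ • G₁ i) ≤
      Submodule.span ℂ (Set.range fun tc : Fin 4 × (Fin (n + 2) × Fin (n + 2)) =>
          (X tc.1 : MvPolynomial (Fin 4) ℂ) *
            aeval (fun ij : Fin (n + 2) × Fin (n + 2) => ∑ t : Fin 4, bord μ⁻¹ ij t • (X t : MvPolynomial (Fin 4) ℂ))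
              (pderiv tc.2 (perPoly (Fin (n + 2)) ℂ))) := by
    rw [Submodule.span_le]
    rintro _ ⟨i, rfl⟩
    rcases i with tc | t | tk | tl
    · -- old row, old column: affine in the corner
      obtain ⟨t, k, l⟩ := tc
      have hd := pb_permanent_submatrix_castSucc_castSucc (B μ⁻¹) (B 0) A (hBA μ⁻¹) (hrows μ⁻¹)
        (hlastrow μ⁻¹) hcorner0 k l
      have key : G₀ (Sum.inl (t, (k, l))) + μ • G₁ (Sum.inl (t, (k, l))) =
          μ • ((X t : MvPolynomial (Fin 4) ℂ) *
            ((B μ⁻¹).submatrix (Fin.castSucc k).succAbove (Fin.castSucc l).succAbove).permanent) := by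
        simp only [G₀, G₁, Sum.elim_inl, F₁, Q₁, hminor, hd, hBw]
        rw [show lin w = ∑ t : Fin 4, w t • (X t : MvPolynomial (Fin 4) ℂ) from rfl]
        simp only [smul_eq_C_mul, mul_add, ← mul_assoc]
        congr 1
        rw [show (C μ * X t * C μ⁻¹ * ∑ x : Fin 4, C (w x) * X x) =
            (C μ * C μ⁻¹) * ((∑ x : Fin 4, C (w x) * X x) * X t) by ring, ← C_mul,
          mul_inv_cancel₀ hμ0, C_1, one_mul]
      show G₀ _ + μ • G₁ _ ∈ _
      rw [key]
      exact Submodule.smul_mem _ _ (hgen μ⁻¹ t _ _)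
    · -- the corner minor: `per M`
      have key : G₀ (Sum.inr (Sum.inl t)) + μ • G₁ (Sum.inr (Sum.inl t)) =
          (X t : MvPolynomial (Fin 4) ℂ) *
            ((B μ⁻¹).submatrix (Fin.last (n + 1)).succAbove (Fin.last (n + 1)).succAbove).permanent := by
        simp only [G₀, G₁, Sum.elim_inr, Sum.elim_inl, F₂, Pi.zero_apply, smul_zero, add_zero, hper,
          pb_submatrix_last_last (B μ⁻¹) A (hBA μ⁻¹)]
      show G₀ _ + μ • G₁ _ ∈ _
      rw [key]
      exact hgen μ⁻¹ t _ _
    · -- old row, border column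
      obtain ⟨t, k⟩ := tk
      have key : G₀ (Sum.inr (Sum.inr (Sum.inl (t, k)))) + μ • G₁ (Sum.inr (Sum.inr (Sum.inl (t, k)))) =
          (X t : MvPolynomial (Fin 4) ℂ) *
            ((B μ⁻¹).submatrix (Fin.castSucc k).succAbove (Fin.last (n + 1)).succAbove).permanent := by
        simp only [G₀, G₁, Sum.elim_inr, Sum.elim_inl, F₃, Pi.zero_apply, smul_zero, add_zero, hminor,
          pb_permanent_submatrix_castSucc_last (B μ⁻¹) A (fun j => lin (v j)) (hBA μ⁻¹) (hBv μ⁻¹) k]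
        rfl
      show G₀ _ + μ • G₁ _ ∈ _
      rw [key]
      exact hgen μ⁻¹ t _ _
    · -- border row, old column
      obtain ⟨t, l⟩ := tl
      have key : G₀ (Sum.inr (Sum.inr (Sum.inr (t, l)))) + μ • G₁ (Sum.inr (Sum.inr (Sum.inr (t, l)))) =
          (X t : MvPolynomial (Fin 4) ℂ) *
            ((B μ⁻¹).submatrix (Fin.last (n + 1)).succAbove (Fin.castSucc l).succAbove).permanent := by
        simp only [G₀, G₁, Sum.elim_inr, F₄, Pi.zero_apply, smul_zero, add_zero, hminor,
          pb_permanent_submatrix_last_castSucc (B μ⁻¹) A (fun i => lin (u i)) (hBA μ⁻¹) (hBu μ⁻¹) l]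
        rfl
      show G₀ _ + μ • G₁ _ ∈ _
      rw [key]
      exact hgen μ⁻¹ t _ _
  calc Module.finrank ℂ _ ≤ Module.finrank ℂ ↥(Submodule.span ℂ (Set.range G₀)) := Submodule.finrank_mono hN
    _ ≤ Module.finrank ℂ ↥(Submodule.span ℂ (Set.range fun i => G₀ i + μ • G₁ i)) := hμ
    _ ≤ _ := Submodule.finrank_mono hGμ

end Summit.ValiantsHypothesis.ValiantsHypothesis.Theorems.ValuativeFlip
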